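import Summits.QuantumFields.YangMills.Theorems.FemtoTransferGapTranslation
import Summits.QuantumFields.YangMills.Theorems.FemtoTransferGapSlab
import HarnessLib

/-!
# Translation invariance of the TORELON ONE-POINT FUNCTIONS of the vacuum: `⟨f_x Ω, Ω⟩ = ⟨f_y Ω, Ω⟩ = ⟨F Ω, Ω⟩`
# (the shared KINEMATIC lemma (ii) of LINE g17-A / g17-B, planner ym-idea-4 g17; ⟨stmt-QuantumFields-23362⟩ helper lane)

Planner ym-idea-4 g17's stub guide lists, as a lemma shared by `AdjointLoopDirichletWeak` ⟨23362⟩ (stub 2), `MeanLoopCeilingWeak` ⟨23353⟩,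
`CurrentCommutatorCeiling` ⟨23379⟩ and `CurrentNormFloor` ⟨23380⟩: «KINEMATIC translation invariance of one-point functions of the simple top
eigenvector, `l2 (f_x•Ω) Ω = l2 (F•Ω) Ω`» — the Polyakov-lift observable at base point `x` (`flowLiftAt x 0 f`) and its site average
(`flowLift 0 f`) have the same vacuum mean.  With ✓`…FemtoTransferGapTranslation` (every raw vacuum is translation invariant pointwise; one-point
functions of the vacuum are translation invariant) this is bookkeeping:
* §1 `lineHolonomy_configTranslate`, `polyakovSite_configTranslate`, `flowLiftAt_zero_configTranslate` — the Polyakov triple at `x` of the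
  translated field `T_v U` is the Polyakov triple of `U` at `v + x` (flow time `0`, ✓`wilsonFlow_zero`);
* §2 ★★ `l2_flowLiftAt_mul_vacuum_eq` — for every physical `Ω` with `K_βΩ = λ₀Ω` (pointwise), every one-site `f` and all base points `x, y`:
  `l2 (f_x·Ω) Ω = l2 (f_y·Ω) Ω`; ★★ `l2_flowLiftAt_mul_vacuum_eq_flowLift` — `l2 (f_x·Ω) Ω = l2 (F·Ω) Ω` with `F = flowLift 0 f` the site average.

HONEST FRAMING: fixed-lattice symmetry bookkeeping (`--supports 23362`); no stub, crux, rung or summit statement is proved; nothing about infinite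
volume, the continuum or the Yang–Mills mass gap.  No `sorry`, no new definition.  References: [cite: Luscher1983, §2]; [cite: Luscher2010, (1.3)–(1.4)];
[cite: ReedSimonIV1978, Thm. XIII.43].
-/

set_option autoImplicit false

noncomputable section

open MeasureTheory Filter Topology
open Literature.MathematicalPhysics.QuantumFieldTheory
open Literature.MathematicalPhysics.QuantumLattice
open scoped BigOperators

namespace Summit.QuantumFields.YangMills.Theorems.FemtoTransferGap

/-! ## §1 The Polyakov triple of a translated field -/

section Lift

variable {G : Type*} [Group G] [MeasurableSpace G] {L : ℕ}

/-- The straight-line holonomy of the translated field: `P(T_v U; k, n, y) = P(U; k, n, v + y)`. [cite: Luscher1983, §2] -/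
theorem lineHolonomy_configTranslate (v : Site 3 L) (U : GaugeConfig 3 L G) (k : Fin 3) :
    ∀ (n : ℕ) (y : Site 3 L), lineHolonomy (configTranslate v U) k n y = lineHolonomy U k n (v + y) := by
  intro n
  induction n with
  | zero => intro y; simp only [lineHolonomy_zero]
  | succ n ih =>
    intro y
    rw [lineHolonomy_succ, lineHolonomy_succ, ih, configTranslate_apply_edge, Site.add_shift]

/-- The Polyakov triple at `x` of the translated field is the Polyakov triple at `v + x`. [cite: Luscher1983, §2] -/
theorem polyakovSite_configTranslate (v x : Site 3 L) (U : GaugeConfig 3 L G) :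
    polyakovSite x (configTranslate v U) = polyakovSite (v + x) U := by
  funext e
  simp only [polyakovSite, lineHolonomy_configTranslate]

end Lift

section LiftSU2

variable {L : ℕ} [NeZero L]

/-- At flow time `0`: `f_x (T_v U) = f_{v+x} (U)` for the Polyakov-lift observable `f_x = flowLiftAt x 0 f`. [cite: Luscher2010, (1.3)–(1.4)] -/
theorem flowLiftAt_zero_configTranslate (v x : Site 3 L) (f : GaugeConfig 3 1 SU2 → ℝ) (U : GaugeConfig 3 L SU2) :
    flowLiftAt x 0 f (configTranslate v U) = flowLiftAt (v + x) 0 f U := by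
  simp only [flowLiftAt, wilsonFlow_zero, polyakovSite_configTranslate]

/-! ## §2 ★★ One-point functions of the Polyakov lift do not depend on the base point -/

/-- ★★ **`⟨f_x Ω, Ω⟩ = ⟨f_y Ω, Ω⟩`**: in every physical exact vacuum (`K_βΩ = λ₀Ω` pointwise; normalised or not) the mean of the Polyakov-lift
observable `f_x = flowLiftAt x 0 f` does not depend on the base point (translate by `y − x`; ✓`integral_comp_configTranslate_mul_rawVacuum_sq`).
[cite: Luscher1983, §2] [cite: ReedSimonIV1978, Thm. XIII.43] -/
theorem l2_flowLiftAt_mul_vacuum_eq (β : ℝ) {Ω : GaugeConfig 3 L SU2 → ℝ} (hΩ : IsPhys Ω)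
    (heig : transferApply β Ω = topValue su2Rep L β • Ω) (f : GaugeConfig 3 1 SU2 → ℝ) (x y : Site 3 L) :
    l2 (fun U => flowLiftAt x 0 f U * Ω U) Ω = l2 (fun U => flowLiftAt y 0 f U * Ω U) Ω := by
  unfold l2
  have hx : (fun U => flowLiftAt x 0 f U * Ω U * Ω U) = fun U => flowLiftAt x 0 f U * Ω U ^ 2 := by funext U; ring
  have hy : (fun U => flowLiftAt y 0 f U * Ω U * Ω U) = fun U => flowLiftAt y 0 f U * Ω U ^ 2 := by funext U; ring
  rw [hx, hy]
  -- `f_y = f_x ∘ T_{y − x}`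
  have h1 : (fun U => flowLiftAt y 0 f U * Ω U ^ 2) = fun U => flowLiftAt x 0 f (configTranslate (y - x) U) * Ω U ^ 2 := by
    funext U; rw [flowLiftAt_zero_configTranslate, sub_add_cancel]
  rw [h1]
  exact (integral_comp_configTranslate_mul_rawVacuum_sq β hΩ heig (y - x) (flowLiftAt x 0 f)).symm

/-- ★★ **`⟨f_x Ω, Ω⟩ = ⟨F Ω, Ω⟩`** with `F = flowLift 0 f` the site average of the `f_y` (`f` bounded measurable) — the shared KINEMATIC
lemma (ii) of LINES g17-A/B (planner ym-idea-4 g17: consumed by ⟨23362⟩ stub 2, ⟨23353⟩, ⟨23379⟩, ⟨23380⟩).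
[cite: Luscher1983, §2] [cite: Luscher2010, (1.3)–(1.4)] -/
theorem l2_flowLiftAt_mul_vacuum_eq_flowLift (β : ℝ) {Ω : GaugeConfig 3 L SU2 → ℝ} (hΩ : IsPhys Ω)
    (heig : transferApply β Ω = topValue su2Rep L β • Ω) {f : GaugeConfig 3 1 SU2 → ℝ} (hfm : Measurable f) {C : ℝ}
    (hfb : ∀ u, |f u| ≤ C) (x : Site 3 L) :
    l2 (fun U => flowLiftAt x 0 f U * Ω U) Ω = l2 (fun U => flowLift 0 f U * Ω U) Ω := by
  haveI : SecondCountableTopology SU2 := secondCountableTopology_su2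
  obtain ⟨CΩ, hCΩ⟩ := hΩ.bounded
  have hCΩ0 : 0 ≤ CΩ := (abs_nonneg _).trans (hCΩ (fun _ => 1))
  have hC0 : 0 ≤ C := (abs_nonneg _).trans (hfb (fun _ => 1))
  have hcard : (0 : ℝ) < (Fintype.card (Site 3 L) : ℝ) := by exact_mod_cast Fintype.card_pos
  -- every `f_y Ω Ω` is integrable (bounded measurable)
  have hmeas : ∀ y : Site 3 L, Measurable (flowLiftAt (L := L) y 0 f) := fun y =>
    hfm.comp ((continuous_polyakovSite y).comp (continuous_wilsonFlow 0)).measurable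
  have hI : ∀ y : Site 3 L, Integrable (fun U => flowLiftAt y 0 f U * Ω U * Ω U) (configMeasure SU2 L) := fun y =>
    integrable_of_measurable_abs_le _ (((hmeas y).mul hΩ.measurable).mul hΩ.measurable) (C := C * CΩ * CΩ) fun U => by
      rw [abs_mul, abs_mul]
      exact mul_le_mul (mul_le_mul (hfb _) (hCΩ U) (abs_nonneg _) hC0) (hCΩ U) (abs_nonneg _) (by positivity)
  -- each base point gives the same mean
  have hterm : ∀ y : Site 3 L, ∫ U, flowLiftAt y 0 f U * Ω U * Ω U ∂configMeasure SU2 L =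
      ∫ U, flowLiftAt x 0 f U * Ω U * Ω U ∂configMeasure SU2 L := by
    intro y
    have h := l2_flowLiftAt_mul_vacuum_eq β hΩ heig f y x
    unfold l2 at h
    exact h
  -- expand the site average and integrate term by term
  have hsum : (fun U => flowLift 0 f U * Ω U * Ω U) =
      fun U => (Fintype.card (Site 3 L) : ℝ)⁻¹ * ∑ y : Site 3 L, flowLiftAt y 0 f U * Ω U * Ω U := by
    funext U
    simp only [flowLift, div_eq_inv_mul, Finset.mul_sum, Finset.sum_mul]
    exact Finset.sum_congr rfl fun y _ => by ring
  unfold l2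
  rw [hsum, integral_const_mul, integral_finsetSum _ fun y _ => hI y]
  simp only [hterm]
  rw [Finset.sum_const, Finset.card_univ, nsmul_eq_mul, ← mul_assoc, inv_mul_cancel₀ hcard.ne', one_mul]

end LiftSU2

end Summit.QuantumFields.YangMills.Theorems.FemtoTransferGap

end
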